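import Mathlib.RingTheory.WittVector.FrobeniusFractionField
import Mathlib.RingTheory.WittVector.DiscreteValuationRing
import HarnessLib

/-!
# The unramified period of a unit-root Frobenius eigenvalue: `φ(u) = u·a` has a UNIT solution in `W(k̄)`

Topic `Literature/NumberTheory/PAdicHodge`; THEOREMS ONLY (no definition, no named fact, no instance, no `sorry`). Step 1 of the «eigen-frame» /
height-one road for Kato's reciprocity law on the (G)-ORDINARY K★ cells of crux `stmt-BirchSwinnertonDyer-22226` (line `kato_lever`, memo
`Cruxes/StarredOptimalManinUnitFiveSeven/Lines/kato-lever-seam-rec-at-cells.md` §16; step 0 = `FrobeniusUnitRoot`): the unit-root character `ψ`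
(Frobenius ↦ a `p`-adic unit `a`) of an ordinary elliptic curve is de Rham / crystalline with PERIOD a unit `u` of `W(k̄)` solving the Frobenius
equation `φ(u) = u·a` — the rank-one slope-zero case of the Dieudonné–Manin classification (Lang's theorem for `W`). Mathlib's `frobeniusRotation`
solves `φ(b)·a₁ = b·a₂` for Witt vectors with non-zero constant coefficients over an algebraically closed field; dividing out the exact power of `p`
(`WittVector.exists_eq_pow_p_mul'`) makes the solution a unit.

* ★ `WittVector.exists_isUnit_frobenius_eq_mul` — `a.coeff 0 ≠ 0 ⟹ ∃ u unit, frobenius u = u * a`;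
* `WittVector.exists_isUnit_frobenius_mul_eq` — the same for `φ(u)·a = u` (`a.coeff 0 ≠ 0`).

## References
* N. M. Katz, *Crystalline cohomology, Dieudonné modules, and Jacobi sums* (1981), §5 (unit-root splitting; slope-zero `F`-crystals are étale,
  trivialised over `W(k̄)`). [Katz1981CrystallineDieudonne]
-/

noncomputable section

namespace WittVector

variable (p : ℕ) [hp : Fact p.Prime] {k : Type*} [Field k] [CharP k p] [IsAlgClosed k]

/-- ★ **Unit solution of the Frobenius equation `φ(u) = u·a` in `W(k̄)`** for a Witt vector `a` with non-zero constant coefficient (e.g. the image of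
a `p`-adic unit): the period of the unramified character with Frobenius eigenvalue `a`. Mathlib's `frobeniusRotation` (with `a₁ = 1`, `a₂ = a`) gives a
non-zero solution `b`; write `b = p^m · u` with `u` a unit (`exists_eq_pow_p_mul'`); Frobenius fixes `p`, and `W(k̄)` is a domain.
[cite: Katz1981CrystallineDieudonne, §5] -/
theorem exists_isUnit_frobenius_eq_mul (a : WittVector p k) (ha : a.coeff 0 ≠ 0) : ∃ u : WittVector p k, IsUnit u ∧ frobenius u = u * a := by
  have h1 : (1 : WittVector p k).coeff 0 ≠ 0 := by simp
  set b : WittVector p k := frobeniusRotation p h1 ha with hb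
  have hb0 : b ≠ 0 := frobeniusRotation_nonzero p h1 ha
  have hbeq : frobenius b = b * a := by simpa using frobenius_frobeniusRotation p h1 ha
  obtain ⟨m, u, hbu⟩ := exists_eq_pow_p_mul' b hb0
  refine ⟨u, u.isUnit, ?_⟩
  have hpm : ((p : WittVector p k) ^ m) ≠ 0 := pow_ne_zero _ (by exact_mod_cast (WittVector.p_nonzero p k))
  have key : (p : WittVector p k) ^ m * frobenius (u : WittVector p k) = (p : WittVector p k) ^ m * ((u : WittVector p k) * a) := by
    have h := hbeq
    rw [hbu, map_mul, map_pow, map_natCast, mul_assoc] at h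
    exact h
  exact mul_left_cancel₀ hpm key

/-- **Unit solution of `φ(u)·a = u`** (the inverse eigenvalue), same hypotheses. [cite: Katz1981CrystallineDieudonne, §5] -/
theorem exists_isUnit_frobenius_mul_eq (a : WittVector p k) (ha : a.coeff 0 ≠ 0) : ∃ u : WittVector p k, IsUnit u ∧ frobenius u * a = u := by
  have h1 : (1 : WittVector p k).coeff 0 ≠ 0 := by simp
  set b : WittVector p k := frobeniusRotation p ha h1 with hb
  have hb0 : b ≠ 0 := frobeniusRotation_nonzero p ha h1
  have hbeq : frobenius b * a = b := by simpa using frobenius_frobeniusRotation p ha h1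
  obtain ⟨m, u, hbu⟩ := exists_eq_pow_p_mul' b hb0
  refine ⟨u, u.isUnit, ?_⟩
  have hpm : ((p : WittVector p k) ^ m) ≠ 0 := pow_ne_zero _ (by exact_mod_cast (WittVector.p_nonzero p k))
  have key : (p : WittVector p k) ^ m * (frobenius (u : WittVector p k) * a) = (p : WittVector p k) ^ m * (u : WittVector p k) := by
    have h := hbeq
    rw [hbu, map_mul, map_pow, map_natCast, mul_assoc] at h
    exact h
  exact mul_left_cancel₀ hpm key

end WittVector

end
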